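import Summits.AtomisticToContinuum.Crystallization.Theses.ThreeConeCertificate

/-!
# Crux `ExactCertificate` (stmt-AtomisticToContinuum-11959), line `Ideator5Sketch`
# (`robust-soft-flyspeck`): the stub `stub_localToGlobal`

Support file — nothing here closes an item.  The line certifies a finite-range pair potential `g`
by a ONE-CENTRE inequality: at every motif site `x` of every periodic configuration `Q` of `ℝ³`,
half the `g`-site-sum plus a transfer `T Q x` is `≥ -c`, the transfers summing to zero over each
motif.  This file proves the bookkeeping step (local-to-global with zero-sum transfers, periodic
form): summing the site inequality over the motif, the transfers cancel, and dividing by the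
number of motif sites gives `-c ≤ e_Q(g)`, where
`e_Q(g) = (2·#motif)⁻¹ Σ_{x ∈ motif} Σ'_{y ∈ Q ∖ x} g(|x - y|)` is
`PeriodicConfiguration.energyPerParticle`.  No summability is needed: both sides carry the same
`tsum`.
-/

noncomputable section

namespace Summit.AtomisticToContinuum.Crystallization.Theorems.ThreeConeCertificateExactCertificate.Design

open Literature.MathematicalPhysics.StatisticalMechanics
open scoped BigOperators

/-- **Local-to-global with zero-sum transfers, periodic form.**  If the site functional
"half the `g`-site-sum plus transfer" is `≥ -c` at every motif site of every periodic
configuration of `ℝ³` and the transfers sum to zero over each motif, then `-c ≤ e_Q(g)` for every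
periodic `Q`: sum the site inequality over the motif (the transfers cancel) and divide by
`#motif > 0`. [folklore] -/
theorem stub_localToGlobal : ∀ (g : ℝ → ℝ) (c : ℝ)
    (T : PeriodicConfiguration 3 → EuclideanSpace ℝ (Fin 3) → ℝ),
    (∀ Q : PeriodicConfiguration 3, ∑ x ∈ Q.motif, T Q x = 0) →
    (∀ (Q : PeriodicConfiguration 3) (x : EuclideanSpace ℝ (Fin 3)), x ∈ Q.motif →
      -c ≤ (2 : ℝ)⁻¹ *
        (∑' y : {y : EuclideanSpace ℝ (Fin 3) // y ∈ Q.points ∧ y ≠ x}, g (dist x y.1)) + T Q x) →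
    ∀ Q : PeriodicConfiguration 3, -c ≤ Q.energyPerParticle g := by
  intro g c T hzero hloc Q
  have hcard : (0 : ℝ) < Q.motif.card := by exact_mod_cast Finset.card_pos.2 Q.motif_nonempty
  -- sum the site inequality over the motif; the transfers cancel
  have hsum := Finset.sum_le_sum fun x hx => hloc Q x hx
  rw [Finset.sum_const, nsmul_eq_mul, Finset.sum_add_distrib, hzero Q, add_zero,
    ← Finset.mul_sum] at hsum
  -- divide by the (positive) number of motif sites
  unfold PeriodicConfiguration.energyPerParticle
  rw [mul_inv, mul_right_comm, ← div_eq_mul_inv, le_div_iff₀ hcard]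
  exact (mul_comm _ _).trans_le hsum

end Summit.AtomisticToContinuum.Crystallization.Theorems.ThreeConeCertificateExactCertificate.Design

end
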